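import Literature.NumberTheory.Sieve.MaynardSieve
import Literature.NumberTheory.Sieve.CoprimeSquarefreeSums
import Literature.NumberTheory.LFunctions.MertensElementary
import HarnessLib

/-!
# Maynard 2015, the level-of-distribution input of Lemma 5.2: divisor-weighted error sums

Topic `Literature/NumberTheory/Sieve`; companion of `MaynardSieve.lean` (`Literature.NumberTheory.Sieve.MaynardPrimesHaveLevel`,
Maynard's hypothesis "the primes have level of distribution `θ`", J. Maynard, *Small gaps between
primes*, Ann. of Math. (2) 181 (2015), 383–413 = arXiv:1311.4600, §1 p. 3) and of
`MaynardSieveS2.lean` (the named fact `Literature.NumberTheory.Sieve.maynard_lemma52` = Lemma 5.2). In the proof of Lemma 5.2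
(pp. 10–11) the hypothesis is consumed once, in the form

  `∑_{r < R²W} μ(r)² τ_{3k}(r) E(N, r) ≪ (∑_r μ² τ_{3k}² (r) N/φ(r))^{1/2} (∑_r μ² E(N, r))^{1/2} ≪_A N/(log N)^A`

("By Cauchy–Schwarz, the trivial bound `E(N, q) ≪ N/φ(q)`, and our hypothesis that the primes have
level of distribution `θ`"), where `E(N, q)` is the maximal error of the count of the primes of
`[N, 2N)` in the reduced classes mod `q`. This file PROVES that step as a self-contained
statement about `MaynardPrimesHaveLevel θ` (the analogue of Goldston–Graham–Pintz–Yıldırım,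
Proc. LMS 98 (2009), Lemma 1, where the weight is `h^{ω(q)}`):

* `primeCountingAPErr x q = max_{(a,q)=1} |π(x; q, a) − π(x)/φ(q)|` (the summand of
  `MaynardPrimesHaveLevel`; `maynardPrimesHaveLevel_iff`), its trivial bound
  `primeCountingAPErr x q ≤ 4x/φ(q)` for `q ≤ x` (`primeCountingAPErr_le`);
* `sum_pow_omega_div_totient_le` — `∑_{q ≤ Q} c^{ω(q)}/φ(q) ≤ exp(2c (∑_{p ≤ Q} 1/p + 1))`
  (Euler product bound for a nonnegative multiplicative function, `CoprimeSquarefreeSums`), whence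
  `≪ (log x)^{2c}` by the tree's Mertens bound `∑_{p ≤ N} 1/p ≤ log log N + 4`
  (`MertensElementary`);
* `MaynardPrimesHaveLevel.le_one` — the hypothesis forces `θ ≤ 1` (for `θ > 1` the moduli
  `2x < q ≤ x^θ` alone contribute `≫ π(x)`, by Chebyshev's bound);
* `MaynardPrimesHaveLevel.isBigO_sum_pow_omega_mul` — THE STEP: for every `K ≥ 0` and `A > 0`,
  `∑_{q ≤ x^θ} K^{ω(q)} max_{(a,q)=1} |π(x; q, a) − π(x)/φ(q)| ≪ x/(log x)^A`
  (Cauchy–Schwarz between `K^{2ω(q)} E_q ≤ 4x K^{2ω(q)}/φ(q)` and `E_q`, the latter summed with the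
  hypothesis at the exponent `2A + 2K²`).

For Lemma 5.2 one takes `K = 3k` (there are at most `τ_{3k}(r)` ways to write a squarefree `r` as
`W ∏ [dᵢ, eᵢ]`) and applies the statement at `x = 2N − 1` and `x = N − 1` with the moduli
`q < R² W ≤ x^θ`.

## References

* J. Maynard, *Small gaps between primes*, Ann. of Math. (2) 181 (2015), 383–413,
  doi:10.4007/annals.2015.181.1.7, arXiv:1311.4600 [MaynardAnnals2015]: §1 (level of
  distribution, p. 3), proof of Lemma 5.2 (the error terms, pp. 10–11).
* D. A. Goldston, S. W. Graham, J. Pintz, C. Y. Yıldırım, *Small gaps between products of two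
  primes*, Proc. Lond. Math. Soc. (3) 98 (2009), 741–774 = arXiv:math/0609615, Lemma 1 (p. 6).
-/

noncomputable section

open Finset Filter Asymptotics
open scoped BigOperators ArithmeticFunction.omega

namespace Literature.NumberTheory.Sieve

/-! ### The AP error of the prime counting function and its trivial bound -/

/-- `max_{(a,q)=1} |π(x; q, a) − π(x)/φ(q)|`, the summand of Maynard's level-of-distribution
hypothesis (`MaynardPrimesHaveLevel`; Maynard 2015 §1, p. 3), for real `x` (via `⌊x⌋`).
[cite: MaynardAnnals2015, §1, definition of level of distribution θ (p. 3)] -/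
def primeCountingAPErr (x : ℝ) (q : ℕ) : ℝ :=
  ⨆ a : (ZMod q)ˣ, |(LevelOfDistribution.primeCountingMod q (a : ZMod q).val ⌊x⌋₊ : ℝ) -
    (Nat.primeCounting ⌊x⌋₊ : ℝ) / Nat.totient q|

/-- `MaynardPrimesHaveLevel θ` unfolded with `primeCountingAPErr`. [cite: MaynardAnnals2015, §1, definition of level of distribution θ (p. 3)] -/
theorem maynardPrimesHaveLevel_iff {θ : ℝ} :
    MaynardPrimesHaveLevel θ ↔ ∀ A : ℝ, 0 < A →
      (fun x : ℝ => ∑ q ∈ Icc 1 ⌊x ^ θ⌋₊, primeCountingAPErr x q) =O[atTop]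
        fun x : ℝ => x / Real.log x ^ A :=
  Iff.rfl

/-- The AP error is nonnegative. [folklore] -/
theorem primeCountingAPErr_nonneg (x : ℝ) (q : ℕ) : 0 ≤ primeCountingAPErr x q :=
  Real.iSup_nonneg fun _ => abs_nonneg _

/-- Each class error is at most the maximal one (`q ≥ 1`). [folklore] -/
theorem abs_sub_le_primeCountingAPErr (x : ℝ) {q : ℕ} (a : (ZMod q)ˣ) :
    |(LevelOfDistribution.primeCountingMod q (a : ZMod q).val ⌊x⌋₊ : ℝ) - (Nat.primeCounting ⌊x⌋₊ : ℝ) / Nat.totient q|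
      ≤ primeCountingAPErr x q := by
  exact le_ciSup (f := fun a : (ZMod q)ˣ => |(LevelOfDistribution.primeCountingMod q (a : ZMod q).val ⌊x⌋₊ : ℝ) -
    (Nat.primeCounting ⌊x⌋₊ : ℝ) / Nat.totient q|) (Set.finite_range _).bddAbove a

/-- `π(x; q, a) ≤ #{n ≤ x : n ≡ a (mod q)} ≤ x/q + 2`. [folklore] -/
theorem primeCountingMod_le (q a x : ℕ) (hq : 0 < q) : LevelOfDistribution.primeCountingMod q a x ≤ x / q + 2 := by
  unfold LevelOfDistribution.primeCountingMod
  calc #{p ∈ range (x + 1) | p.Prime ∧ p ≡ a [MOD q]}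
      ≤ #{p ∈ range (x + 1) | p ≡ a [MOD q]} :=
        Finset.card_le_card (Finset.monotone_filter_right _ fun p _ hp => hp.2)
    _ = (x + 1).count (· ≡ a [MOD q]) := (Nat.count_eq_card_filter_range _ _).symm
    _ ≤ (x + 1) / q + 1 := by
        rw [Nat.count_modEq_card _ hq]
        split_ifs <;> omega
    _ ≤ x / q + 2 := by
        have : (x + 1) / q ≤ x / q + 1 := by
          calc (x + 1) / q ≤ (x + q) / q := Nat.div_le_div_right (by omega)
            _ = x / q + 1 := Nat.add_div_right x hq
        omega

/-- **The trivial bound** `max_{(a,q)=1} |π(x; q, a) − π(x)/φ(q)| ≤ 4x/φ(q)` for `1 ≤ q ≤ x`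
("the trivial bound `E(N, q) ≪ N/φ(q)`", Maynard 2015, proof of Lemma 5.2). [cite: MaynardAnnals2015, proof of Lemma 5.2 (the trivial bound E(N,q) ≪ N/φ(q))] -/
theorem primeCountingAPErr_le {x : ℝ} {q : ℕ} (hq : 1 ≤ q) (hqx : (q : ℝ) ≤ x) :
    primeCountingAPErr x q ≤ 4 * x / Nat.totient q := by
  haveI : NeZero q := ⟨by omega⟩
  have hx1 : (1 : ℝ) ≤ x := le_trans (by exact_mod_cast hq) hqx
  have hφpos : (0 : ℝ) < Nat.totient q := by exact_mod_cast Nat.totient_pos.2 hq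
  have hφq : (Nat.totient q : ℝ) ≤ q := by exact_mod_cast Nat.totient_le q
  have hφx : (Nat.totient q : ℝ) ≤ x := hφq.trans hqx
  have hfl : ((⌊x⌋₊ : ℕ) : ℝ) ≤ x := Nat.floor_le (by linarith)
  refine ciSup_le fun a => ?_
  rw [abs_le]
  have hπ : (Nat.primeCounting ⌊x⌋₊ : ℝ) ≤ x := by
    have : Nat.primeCounting ⌊x⌋₊ ≤ ⌊x⌋₊ := by
      rw [← Nat.primesLE_card_eq_primeCounting, Nat.primesLE_eq_filter_Icc_one]
      exact (Finset.card_filter_le _ _).trans (by simp)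
    calc (Nat.primeCounting ⌊x⌋₊ : ℝ) ≤ ((⌊x⌋₊ : ℕ) : ℝ) := by exact_mod_cast this
      _ ≤ x := hfl
  have hπq : (LevelOfDistribution.primeCountingMod q (a : ZMod q).val ⌊x⌋₊ : ℝ) ≤ x / Nat.totient q + 2 := by
    have h1 := primeCountingMod_le q (a : ZMod q).val ⌊x⌋₊ (by omega)
    have h2 : ((⌊x⌋₊ / q : ℕ) : ℝ) ≤ x / q := by
      calc ((⌊x⌋₊ / q : ℕ) : ℝ) ≤ ((⌊x⌋₊ : ℕ) : ℝ) / q := Nat.cast_div_le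
        _ ≤ x / q := by gcongr
    have h3 : x / q ≤ x / Nat.totient q := div_le_div_of_nonneg_left (by linarith) hφpos hφq
    calc (LevelOfDistribution.primeCountingMod q (a : ZMod q).val ⌊x⌋₊ : ℝ) ≤ ((⌊x⌋₊ / q + 2 : ℕ) : ℝ) := by
          exact_mod_cast h1
      _ = ((⌊x⌋₊ / q : ℕ) : ℝ) + 2 := by push_cast; ring
      _ ≤ x / Nat.totient q + 2 := by linarith
  have hdiv : (Nat.primeCounting ⌊x⌋₊ : ℝ) / Nat.totient q ≤ x / Nat.totient q := by gcongr
  have hone : 1 ≤ x / Nat.totient q := by rw [le_div_iff₀ hφpos]; linarith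
  have h0a : 0 ≤ (LevelOfDistribution.primeCountingMod q (a : ZMod q).val ⌊x⌋₊ : ℝ) := Nat.cast_nonneg _
  have h0b : 0 ≤ (Nat.primeCounting ⌊x⌋₊ : ℝ) / Nat.totient q := by positivity
  have h4 : 4 * x / Nat.totient q = 4 * (x / Nat.totient q) := by ring
  constructor <;> nlinarith

/-! ### `∑_{q ≤ Q} c^{ω(q)}/φ(q) ≪ (log Q)^{2c}` -/

/-- `q ↦ c^{ω(q)}/φ(q)` (`q ≥ 1`; value `0` at `0`) as a real arithmetic function. [folklore] -/
def powOmegaDivTotient (c : ℝ) : ArithmeticFunction ℝ :=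
  ⟨fun n => if n = 0 then 0 else c ^ ω n / (n.totient : ℝ), by simp⟩

/-- Unfolding `powOmegaDivTotient` at `n ≥ 1`. [folklore] -/
theorem powOmegaDivTotient_apply {c : ℝ} {n : ℕ} (hn : n ≠ 0) :
    powOmegaDivTotient c n = c ^ ω n / (n.totient : ℝ) := by
  simp [powOmegaDivTotient, hn]

/-- `c^{ω}/φ` is multiplicative. [folklore] -/
theorem isMultiplicative_powOmegaDivTotient (c : ℝ) : (powOmegaDivTotient c).IsMultiplicative := by
  refine ⟨by simp [powOmegaDivTotient], fun {m n} hmn => ?_⟩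
  rcases Nat.eq_zero_or_pos m with rfl | hm
  · simp [powOmegaDivTotient]
  rcases Nat.eq_zero_or_pos n with rfl | hn
  · simp [powOmegaDivTotient]
  rw [powOmegaDivTotient_apply (Nat.mul_ne_zero hm.ne' hn.ne'), powOmegaDivTotient_apply hm.ne',
    powOmegaDivTotient_apply hn.ne', ArithmeticFunction.cardDistinctFactors_mul hmn,
    Nat.totient_mul hmn, pow_add, Nat.cast_mul]
  rw [div_mul_div_comm]

/-- `c^{ω}/φ ≥ 0` for `c ≥ 0`. [folklore] -/
theorem powOmegaDivTotient_nonneg {c : ℝ} (hc : 0 ≤ c) (n : ℕ) : 0 ≤ powOmegaDivTotient c n := by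
  by_cases hn : n = 0
  · simp [powOmegaDivTotient, hn]
  · rw [powOmegaDivTotient_apply hn]; positivity

/-- The local factor: `∑_{j ≤ Q} c^{ω(p^j)}/φ(p^j) ≤ 1 + 2c/(p − 1)` (`∑_{j ≥ 1} 1/φ(p^j) = p/(p−1)² ≤ 2/(p−1)`).
[folklore] -/
theorem sum_range_powOmegaDivTotient_prime_pow_le {c : ℝ} (hc : 0 ≤ c) {p : ℕ} (hp : p.Prime)
    (Q : ℕ) :
    ∑ j ∈ Finset.range (Q + 1), powOmegaDivTotient c (p ^ j) ≤ 1 + 2 * c / ((p : ℝ) - 1) := by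
  have hp2 : (2 : ℝ) ≤ p := by exact_mod_cast hp.two_le
  have hp1 : (0 : ℝ) < (p : ℝ) - 1 := by linarith
  have hppos : (0 : ℝ) < p := by linarith
  rw [Finset.range_eq_Ico, Finset.sum_eq_sum_Ico_succ_bot (by omega : 0 < Q + 1), pow_zero,
    (isMultiplicative_powOmegaDivTotient c).map_one]
  have hterm : ∀ j ∈ Finset.Ico 1 (Q + 1), powOmegaDivTotient c (p ^ j) =
      c / ((p : ℝ) - 1) * ((p : ℝ)⁻¹) ^ (j - 1) := by
    intro j hj
    have hj1 : 1 ≤ j := (Finset.mem_Ico.1 hj).1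
    rw [powOmegaDivTotient_apply (pow_ne_zero _ hp.ne_zero),
      ArithmeticFunction.cardDistinctFactors_apply_prime_pow hp (by omega), pow_one,
      Nat.totient_prime_pow hp (by omega)]
    rw [Nat.cast_mul, Nat.cast_pow, Nat.cast_sub hp.one_lt.le, Nat.cast_one, inv_pow]
    field_simp
  rw [Finset.sum_congr rfl hterm, ← Finset.mul_sum]
  have hgeom : ∑ j ∈ Finset.Ico 1 (Q + 1), ((p : ℝ)⁻¹) ^ (j - 1) ≤ 2 := by
    have hshift : ∑ j ∈ Finset.Ico 1 (Q + 1), ((p : ℝ)⁻¹) ^ (j - 1) =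
        ∑ i ∈ Finset.range Q, ((p : ℝ)⁻¹) ^ i := by
      rw [Finset.sum_Ico_eq_sum_range, Nat.add_sub_cancel]
      refine Finset.sum_congr rfl fun j _ => ?_
      rw [Nat.add_sub_cancel_left]
    rw [hshift, Finset.range_eq_Ico]
    have hx0 : (0 : ℝ) ≤ (p : ℝ)⁻¹ := by positivity
    have hx1 : (p : ℝ)⁻¹ < 1 := inv_lt_one_of_one_lt₀ (by linarith)
    calc ∑ i ∈ Finset.Ico 0 Q, ((p : ℝ)⁻¹) ^ i ≤ ((p : ℝ)⁻¹) ^ 0 / (1 - (p : ℝ)⁻¹) :=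
          geom_sum_Ico_le_of_lt_one hx0 hx1
      _ = p / ((p : ℝ) - 1) := by
          rw [pow_zero]; field_simp
      _ ≤ 2 := by rw [div_le_iff₀ hp1]; linarith
  have hcp : 0 ≤ c / ((p : ℝ) - 1) := by positivity
  calc 1 + c / ((p : ℝ) - 1) * ∑ j ∈ Finset.Ico 1 (Q + 1), ((p : ℝ)⁻¹) ^ (j - 1)
      ≤ 1 + c / ((p : ℝ) - 1) * 2 := by gcongr
    _ = 1 + 2 * c / ((p : ℝ) - 1) := by ring

/-- **`∑_{q ≤ Q} c^{ω(q)}/φ(q) ≤ exp(2c (∑_{p ≤ Q} 1/p + 1))`** for `c ≥ 0` (the sum behind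
"`∑_{r<R²W} μ(r)² τ_{3k}(r)² N/φ(r)`" in the proof of Lemma 5.2; Euler product of the nonnegative
multiplicative function `c^ω/φ`, `1 + 2c/(p−1) ≤ exp(2c/(p−1))`, `1/(p−1) = 1/p + 1/(p(p−1))` and
`∑_p 1/(p(p−1)) ≤ 1`). [cite: MaynardAnnals2015, proof of Lemma 5.2 (the Cauchy–Schwarz step)] -/
theorem sum_pow_omega_div_totient_le {c : ℝ} (hc : 0 ≤ c) (Q : ℕ) :
    ∑ q ∈ Icc 1 Q, c ^ ω q / (Nat.totient q : ℝ) ≤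
      Real.exp (2 * c * (∑ p ∈ Nat.primesLE Q, (1 : ℝ) / p + 1)) := by
  have h1 : ∑ q ∈ Icc 1 Q, c ^ ω q / (Nat.totient q : ℝ) = ∑ q ∈ Icc 1 Q, powOmegaDivTotient c q :=
    Finset.sum_congr rfl fun q hq => by
      rw [powOmegaDivTotient_apply (by have := (Finset.mem_Icc.1 hq).1; omega)]
  rw [h1]
  refine (SquarefreeSums.sum_le_prod_sum_prime_pow (isMultiplicative_powOmegaDivTotient c)
    (powOmegaDivTotient_nonneg hc) Q).trans ?_
  have hprimes : Nat.primesBelow (Q + 1) = Nat.primesLE Q := by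
    ext p; simp [Nat.mem_primesBelow, Nat.primesLE]
  rw [hprimes]
  calc ∏ p ∈ Nat.primesLE Q, ∑ j ∈ Finset.range (Q + 1), powOmegaDivTotient c (p ^ j)
      ≤ ∏ p ∈ Nat.primesLE Q, (1 + 2 * c / ((p : ℝ) - 1)) := by
        refine Finset.prod_le_prod (fun p _ => Finset.sum_nonneg fun j _ =>
          powOmegaDivTotient_nonneg hc _) fun p hp => ?_
        exact sum_range_powOmegaDivTotient_prime_pow_le hc (Nat.mem_primesLE.1 hp).2 Q
    _ ≤ Real.exp (∑ p ∈ Nat.primesLE Q, 2 * c / ((p : ℝ) - 1)) :=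
        SquarefreeSums.prod_one_add_le_exp_sum fun p hp => by
          have : (2 : ℝ) ≤ p := by exact_mod_cast (Nat.mem_primesLE.1 hp).2.two_le
          have : (0 : ℝ) < (p : ℝ) - 1 := by linarith
          positivity
    _ ≤ Real.exp (2 * c * (∑ p ∈ Nat.primesLE Q, (1 : ℝ) / p + 1)) := by
        gcongr
        have hsplit : ∑ p ∈ Nat.primesLE Q, 2 * c / ((p : ℝ) - 1) =
            2 * c * (∑ p ∈ Nat.primesLE Q, (1 : ℝ) / p +
              ∑ p ∈ Nat.primesLE Q, (1 : ℝ) / (p * (p - 1))) := by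
          rw [← Finset.sum_add_distrib, Finset.mul_sum]
          refine Finset.sum_congr rfl fun p hp => ?_
          have h2 : (2 : ℝ) ≤ p := by exact_mod_cast (Nat.mem_primesLE.1 hp).2.two_le
          have : (p : ℝ) - 1 ≠ 0 := by linarith
          have : (p : ℝ) ≠ 0 := by linarith
          field_simp
          ring
        rw [hsplit]
        gcongr
        exact LFunctions.MertensBound.sum_inv_prime_mul_pred_le_one Q


/-! ### `θ ≤ 1` -/

/-- `π(x; q, 1) = 0` for `q > x ≥ 1`: a prime `p ≤ x < q` with `p ≡ 1 (mod q)` would be `1`. [folklore] -/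
theorem primeCountingMod_one_eq_zero {q x : ℕ} (hqx : x < q) : LevelOfDistribution.primeCountingMod q 1 x = 0 := by
  unfold LevelOfDistribution.primeCountingMod
  rw [Finset.card_eq_zero, Finset.filter_eq_empty_iff]
  intro p hp ⟨hprime, hmod⟩
  have hpx : p ≤ x := Nat.lt_succ_iff.1 (Finset.mem_range.1 hp)
  have hq1 : 1 < q := by have := hprime.two_le; omega
  have h1 : p % q = 1 % q := hmod
  rw [Nat.mod_eq_of_lt (by omega), Nat.mod_eq_of_lt hq1] at h1
  exact hprime.ne_one h1

/-- **Maynard's level hypothesis forces `θ ≤ 1`.** For `θ > 1`, each modulus `2x < q ≤ x^θ`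
contributes at least `|π(x; q, 1) − π(x)/φ(q)| = π(x)/φ(q) ≥ π(x)/x^θ`, so the sum is `≥ π(x)/2 ≫ x/log x`
by Chebyshev's bound (Mathlib's `Chebyshev.psi_ge`, `Chebyshev.psi_le_primeCounting_mul_log`),
contradicting the hypothesis with `A = 2`. (Compare `PrimesHaveLevel.le_one`.) [folklore] -/
theorem MaynardPrimesHaveLevel.le_one {θ : ℝ} (h : MaynardPrimesHaveLevel θ) : θ ≤ 1 := by
  by_contra hθ
  push Not at hθ
  have h2 := h 2 two_pos
  obtain ⟨C, hCpos, hC⟩ := h2.exists_pos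
  rw [IsBigOWith] at hC
  obtain ⟨x₀, hx₀⟩ := Filter.eventually_atTop.1 hC
  -- the conditions on `n`, all eventually true
  have hev1 : ∀ᶠ n : ℕ in atTop, x₀ ≤ (n : ℝ) := tendsto_natCast_atTop_atTop.eventually_ge_atTop x₀
  have hev2 : ∀ᶠ n : ℕ in atTop, 6 * (n : ℝ) ≤ (n : ℝ) ^ θ := by
    have ht : Tendsto (fun n : ℕ => (n : ℝ) ^ (θ - 1)) atTop atTop :=
      (tendsto_rpow_atTop (by linarith)).comp tendsto_natCast_atTop_atTop
    filter_upwards [ht.eventually_ge_atTop 6, eventually_ge_atTop 1] with n hn hn1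
    have hn0 : (0 : ℝ) < n := by exact_mod_cast hn1
    calc 6 * (n : ℝ) ≤ (n : ℝ) ^ (θ - 1) * n := by nlinarith
      _ = (n : ℝ) ^ θ := by rw [Real.rpow_sub_one hn0.ne']; field_simp
  have hev3 : ∀ᶠ n : ℕ in atTop, 8 * C / Real.log 2 + 1 ≤ Real.log n :=
    (Real.tendsto_log_atTop.comp tendsto_natCast_atTop_atTop).eventually_ge_atTop _
  have hev4 : ∀ᶠ n : ℕ in atTop, Real.log ((n : ℝ) + 1) ≤ Real.log 2 / 4 * ((n : ℝ) + 1) := by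
    have hb := Real.isLittleO_log_id_atTop.bound (show 0 < Real.log 2 / 4 by positivity)
    have ht : Tendsto (fun n : ℕ => (n : ℝ) + 1) atTop atTop :=
      tendsto_natCast_atTop_atTop.atTop_add tendsto_const_nhds
    filter_upwards [ht.eventually hb] with n hn
    have h0 : (0 : ℝ) < (n : ℝ) + 1 := by positivity
    have h1 : 0 ≤ Real.log ((n : ℝ) + 1) := Real.log_nonneg (by linarith [(Nat.cast_nonneg n : (0:ℝ) ≤ n)])
    rw [Real.norm_of_nonneg h1, id, Real.norm_of_nonneg h0.le] at hn
    exact hn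
  obtain ⟨n, hn1, hn2, hn3, hn4, hn5⟩ :=
    (hev1.and (hev2.and (hev3.and (hev4.and (eventually_ge_atTop 2))))).exists
  -- notation at `x = n`
  have hn0 : (0 : ℝ) < n := by exact_mod_cast (show 0 < n by omega)
  have hlog2 : 0 < Real.log 2 := Real.log_pos one_lt_two
  have hlogn : 0 < Real.log n := Real.log_pos (by exact_mod_cast (show 1 < n by omega))
  have hCn := hx₀ n hn1
  set Q := ⌊(n : ℝ) ^ θ⌋₊ with hQ
  change ‖∑ q ∈ Icc 1 Q, primeCountingAPErr (n : ℝ) q‖ ≤ C * ‖(n : ℝ) / Real.log n ^ (2 : ℝ)‖ at hCn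
  have hnθ : 0 < (n : ℝ) ^ θ := Real.rpow_pos_of_pos hn0 θ
  have hQle : (Q : ℝ) ≤ (n : ℝ) ^ θ := Nat.floor_le hnθ.le
  have hQge : (n : ℝ) ^ θ - 1 ≤ Q := by
    have := Nat.lt_floor_add_one ((n : ℝ) ^ θ); rw [← hQ] at this; linarith
  -- upper bound from the hypothesis
  have hupper : ∑ q ∈ Icc 1 Q, primeCountingAPErr n q ≤ C * ((n : ℝ) / Real.log n ^ (2 : ℝ)) := by
    have hnn : 0 ≤ ∑ q ∈ Icc 1 Q, primeCountingAPErr n q :=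
      Finset.sum_nonneg fun q _ => primeCountingAPErr_nonneg _ _
    rwa [Real.norm_of_nonneg hnn,
      Real.norm_of_nonneg (div_nonneg hn0.le (Real.rpow_nonneg hlogn.le 2))] at hCn
  -- lower bound: the moduli `2n < q ≤ Q`
  have hπ : ∀ q ∈ (Icc 1 Q).filter (fun q => 2 * n < q),
      (Nat.primeCounting n : ℝ) / (n : ℝ) ^ θ ≤ primeCountingAPErr n q := by
    intro q hq
    rw [Finset.mem_filter, Finset.mem_Icc] at hq
    obtain ⟨⟨hq1, hqQ⟩, hq2n⟩ := hq
    haveI : Fact (1 < q) := ⟨by omega⟩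
    have hval : ((1 : (ZMod q)ˣ) : ZMod q).val = 1 := by rw [Units.val_one, ZMod.val_one]
    have hE := abs_sub_le_primeCountingAPErr (n : ℝ) (q := q) 1
    rw [hval, Nat.floor_natCast, primeCountingMod_one_eq_zero (by omega : n < q), Nat.cast_zero,
      zero_sub, abs_neg] at hE
    refine le_trans ?_ hE
    have hφpos : (0 : ℝ) < Nat.totient q := by exact_mod_cast Nat.totient_pos.2 (by omega)
    rw [abs_of_nonneg (by positivity)]
    have hφq : (Nat.totient q : ℝ) ≤ (q : ℝ) := by exact_mod_cast Nat.totient_le q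
    have hqQ' : (q : ℝ) ≤ (Q : ℝ) := by exact_mod_cast hqQ
    have hφle : (Nat.totient q : ℝ) ≤ (n : ℝ) ^ θ := hφq.trans (hqQ'.trans hQle)
    exact div_le_div_of_nonneg_left (Nat.cast_nonneg _) hφpos hφle
  have hcard : (n : ℝ) ^ θ / 2 ≤ (((Icc 1 Q).filter (fun q => 2 * n < q)).card : ℝ) := by
    have hset : (Icc 1 Q).filter (fun q => 2 * n < q) = Ioc (2 * n) Q := by
      ext q; simp only [Finset.mem_filter, Finset.mem_Icc, Finset.mem_Ioc]; omega
    rw [hset, Nat.card_Ioc]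
    have hn2r : (2 : ℝ) ≤ n := by exact_mod_cast hn5
    have h6 : 6 * (n : ℝ) ≤ (Q : ℝ) + 1 := hn2.trans (by linarith)
    have hQn : 2 * n ≤ Q := by
      have : ((2 * n : ℕ) : ℝ) ≤ (Q : ℝ) := by push_cast; linarith
      exact_mod_cast this
    rw [Nat.cast_sub hQn]
    push_cast
    linarith
  have hlower : (Nat.primeCounting n : ℝ) / 2 ≤ ∑ q ∈ Icc 1 Q, primeCountingAPErr n q := by
    calc (Nat.primeCounting n : ℝ) / 2 = (n : ℝ) ^ θ / 2 * ((Nat.primeCounting n : ℝ) / (n : ℝ) ^ θ) := by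
          field_simp
      _ ≤ (((Icc 1 Q).filter (fun q => 2 * n < q)).card : ℝ) *
            ((Nat.primeCounting n : ℝ) / (n : ℝ) ^ θ) := by gcongr
      _ = ∑ q ∈ (Icc 1 Q).filter (fun q => 2 * n < q), (Nat.primeCounting n : ℝ) / (n : ℝ) ^ θ := by
          rw [Finset.sum_const, nsmul_eq_mul]
      _ ≤ ∑ q ∈ (Icc 1 Q).filter (fun q => 2 * n < q), primeCountingAPErr n q :=
          Finset.sum_le_sum hπ
      _ ≤ ∑ q ∈ Icc 1 Q, primeCountingAPErr n q :=
          Finset.sum_le_sum_of_subset_of_nonneg (Finset.filter_subset _ _)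
            fun q _ _ => primeCountingAPErr_nonneg _ _
  -- Chebyshev: `π(n) log n ≥ n log 2 − log(n+1) ≥ n log 2 / 2`
  have hcheb : (n : ℝ) * Real.log 2 / 2 ≤ (Nat.primeCounting n : ℝ) * Real.log n := by
    have h1 := Chebyshev.psi_ge n
    have h2 := Chebyshev.psi_le_primeCounting_mul_log n
    have h3 : Real.log ((n : ℝ) + 1) ≤ (n : ℝ) * Real.log 2 / 2 := by
      have : (n : ℝ) + 1 ≤ 2 * n := by
        have : (2 : ℝ) ≤ n := by exact_mod_cast hn5
        linarith
      nlinarith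
    linarith
  -- combine: `n log 2/(4 log n) ≤ π(n)/2 ≤ C n/(log n)²`
  have hfinal : (n : ℝ) * Real.log 2 / 2 ≤ 2 * C * (n : ℝ) / Real.log n := by
    have h1 : (Nat.primeCounting n : ℝ) ≤ 2 * C * ((n : ℝ) / Real.log n ^ (2 : ℝ)) := by linarith
    calc (n : ℝ) * Real.log 2 / 2 ≤ (Nat.primeCounting n : ℝ) * Real.log n := hcheb
      _ ≤ 2 * C * ((n : ℝ) / Real.log n ^ (2 : ℝ)) * Real.log n :=
          mul_le_mul_of_nonneg_right h1 hlogn.le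
      _ = 2 * C * (n : ℝ) / Real.log n := by
          rw [show (2 : ℝ) = ((2 : ℕ) : ℝ) by norm_num, Real.rpow_natCast]
          field_simp
  rw [div_le_div_iff₀ two_pos hlogn] at hfinal
  -- `n log 2 log n ≤ 4 C n`, i.e. `log 2 · log n ≤ 4C`
  have key : Real.log 2 * Real.log n ≤ 4 * C :=
    le_of_mul_le_mul_left (by linarith [hfinal] : (n : ℝ) * (Real.log 2 * Real.log n) ≤ n * (4 * C)) hn0
  have key2 : Real.log 2 * (8 * C / Real.log 2 + 1) ≤ Real.log 2 * Real.log n :=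
    mul_le_mul_of_nonneg_left hn3 hlog2.le
  have key3 : Real.log 2 * (8 * C / Real.log 2 + 1) = 8 * C + Real.log 2 := by field_simp
  linarith

/-! ### The weighted level-of-distribution bound -/

/-- **The level-of-distribution step of Maynard 2015, Lemma 5.2** (pp. 10–11: "By Cauchy–Schwarz,
the trivial bound `E(N,q) ≪ N/φ(q)`, and our hypothesis that the primes have level of distribution
`θ`, this contributes for any fixed `A > 0` … `≪ y_max² N/(log N)^A`"), as a statement about the
hypothesis alone: if the primes have level of distribution `θ` in Maynard's sense then for every
`K ≥ 0` and `A > 0`,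
`∑_{q ≤ x^θ} K^{ω(q)} max_{(a,q)=1} |π(x; q, a) − π(x)/φ(q)| ≪ x/(log x)^A` (`x → ∞`).
Proof: `(∑ K^ω E_q)² ≤ (∑ K^{2ω} E_q)(∑ E_q)`, `E_q ≤ 4x/φ(q)`, `∑_{q ≤ x} K^{2ω(q)}/φ(q) ≪ (log x)^{2K²}`
(`sum_pow_omega_div_totient_le` and Mertens), and the hypothesis with `A' = 2A + 2K²`. This is the
`π`-analogue of Goldston–Graham–Pintz–Yıldırım 2009, Lemma 1. [cite: MaynardAnnals2015, proof of Lemma 5.2 (the level-of-distribution step, pp. 10–11)] -/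
theorem MaynardPrimesHaveLevel.isBigO_sum_pow_omega_mul {θ : ℝ} (h : MaynardPrimesHaveLevel θ)
    {K : ℝ} (hK : 0 ≤ K) {A : ℝ} (hA : 0 < A) :
    (fun x : ℝ => ∑ q ∈ Icc 1 ⌊x ^ θ⌋₊, K ^ ω q * primeCountingAPErr x q) =O[atTop]
      fun x : ℝ => x / Real.log x ^ A := by
  have hθ1 : θ ≤ 1 := h.le_one
  set c := K ^ 2 with hc
  have hc0 : 0 ≤ c := by positivity
  have h2 := h (2 * A + 2 * c) (by positivity)
  obtain ⟨C, hCpos, hC⟩ := h2.exists_pos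
  rw [IsBigOWith] at hC
  set B := 4 * Real.exp (2 * c * 5) * C with hB
  have hB0 : 0 ≤ B := by positivity
  refine IsBigO.of_bound (Real.sqrt B) ?_
  filter_upwards [hC, eventually_ge_atTop (3 : ℝ)] with x hCx hx3
  have hx0 : 0 < x := by linarith
  have hx1 : 1 ≤ x := by linarith
  have hlog1 : 1 ≤ Real.log x := by
    rw [Real.le_log_iff_exp_le hx0]
    have := Real.exp_one_lt_d9
    linarith
  have hlogpos : 0 < Real.log x := by linarith
  set Q := ⌊x ^ θ⌋₊ with hQ
  have hQx : (Q : ℝ) ≤ x := by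
    calc (Q : ℝ) ≤ x ^ θ := Nat.floor_le (by positivity)
      _ ≤ x ^ (1 : ℝ) := Real.rpow_le_rpow_of_exponent_le hx1 hθ1
      _ = x := Real.rpow_one x
  have hE0 : ∀ q, 0 ≤ primeCountingAPErr x q := primeCountingAPErr_nonneg x
  -- Cauchy–Schwarz
  have hCS : (∑ q ∈ Icc 1 Q, K ^ ω q * primeCountingAPErr x q) ^ 2 ≤
      (∑ q ∈ Icc 1 Q, c ^ ω q * primeCountingAPErr x q) * ∑ q ∈ Icc 1 Q, primeCountingAPErr x q := by
    refine Finset.sum_sq_le_sum_mul_sum_of_sq_le_mul _ (fun q _ => mul_nonneg (pow_nonneg hc0 _) (hE0 q))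
      (fun q _ => hE0 q) fun q _ => le_of_eq ?_
    rw [hc]; ring
  -- bound 1: `∑ c^ω E ≤ 4x e^{10c} (log x)^{2c}`
  have hP : ∑ p ∈ Nat.primesLE Q, (1 : ℝ) / p ≤ Real.log (Real.log x) + 4 := by
    rcases le_or_gt 2 Q with hQ2 | hQ2
    · have hQpos : (0 : ℝ) < Q := by exact_mod_cast (show 0 < Q by omega)
      have hlogQ : 0 < Real.log Q := Real.log_pos (by exact_mod_cast (show 1 < Q by omega))
      calc ∑ p ∈ Nat.primesLE Q, (1 : ℝ) / p ≤ Real.log (Real.log Q) + 4 :=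
            LFunctions.MertensBound.sum_inv_prime_le Q hQ2
        _ ≤ Real.log (Real.log x) + 4 := by
            gcongr
    · have hempty : Nat.primesLE Q = ∅ := by
        interval_cases Q
        · exact Nat.primesLE_zero
        · exact Nat.primesLE_one
      rw [hempty, Finset.sum_empty]
      have : 0 ≤ Real.log (Real.log x) := Real.log_nonneg hlog1
      linarith
  have hB1 : ∑ q ∈ Icc 1 Q, c ^ ω q * primeCountingAPErr x q ≤
      4 * x * (Real.exp (2 * c * 5) * Real.log x ^ (2 * c)) := by
    calc ∑ q ∈ Icc 1 Q, c ^ ω q * primeCountingAPErr x q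
        ≤ ∑ q ∈ Icc 1 Q, c ^ ω q * (4 * x / Nat.totient q) := by
          refine Finset.sum_le_sum fun q hq => mul_le_mul_of_nonneg_left ?_ (by positivity)
          have hq1 : 1 ≤ q := (Finset.mem_Icc.1 hq).1
          have hqQ : q ≤ Q := (Finset.mem_Icc.1 hq).2
          exact primeCountingAPErr_le hq1 (le_trans (by exact_mod_cast hqQ) hQx)
      _ = 4 * x * ∑ q ∈ Icc 1 Q, c ^ ω q / (Nat.totient q : ℝ) := by
          rw [Finset.mul_sum]
          refine Finset.sum_congr rfl fun q _ => by ring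
      _ ≤ 4 * x * Real.exp (2 * c * (∑ p ∈ Nat.primesLE Q, (1 : ℝ) / p + 1)) := by
          gcongr
          exact sum_pow_omega_div_totient_le hc0 Q
      _ ≤ 4 * x * Real.exp (2 * c * (Real.log (Real.log x) + 5)) := by
          gcongr 4 * x * Real.exp (2 * c * ?_)
          linarith
      _ = 4 * x * (Real.exp (2 * c * 5) * Real.log x ^ (2 * c)) := by
          rw [show 2 * c * (Real.log (Real.log x) + 5) = 2 * c * 5 + Real.log (Real.log x) * (2 * c) by
            ring, Real.exp_add, Real.rpow_def_of_pos hlogpos]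
  -- bound 2: the hypothesis
  have hB2 : ∑ q ∈ Icc 1 Q, primeCountingAPErr x q ≤ C * (x / Real.log x ^ (2 * A + 2 * c)) := by
    have hnn : 0 ≤ ∑ q ∈ Icc 1 Q, primeCountingAPErr x q := Finset.sum_nonneg fun q _ => hE0 q
    change ‖∑ q ∈ Icc 1 Q, primeCountingAPErr x q‖ ≤ C * ‖x / Real.log x ^ (2 * A + 2 * c)‖ at hCx
    rwa [Real.norm_of_nonneg hnn,
      Real.norm_of_nonneg (div_nonneg hx0.le (Real.rpow_nonneg hlogpos.le _))] at hCx
  -- combine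
  have hS0 : 0 ≤ ∑ q ∈ Icc 1 Q, K ^ ω q * primeCountingAPErr x q :=
    Finset.sum_nonneg fun q _ => mul_nonneg (pow_nonneg hK _) (hE0 q)
  have hxA : 0 ≤ x / Real.log x ^ A := div_nonneg hx0.le (Real.rpow_nonneg hlogpos.le _)
  have hR0 : 0 ≤ Real.sqrt B * (x / Real.log x ^ A) := mul_nonneg (Real.sqrt_nonneg _) hxA
  rw [Real.norm_of_nonneg hS0, Real.norm_of_nonneg hxA]
  rw [← pow_le_pow_iff_left₀ hS0 hR0 two_ne_zero]
  have hL1 : Real.log x ^ (2 * A + 2 * c) = Real.log x ^ (2 * A) * Real.log x ^ (2 * c) :=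
    Real.rpow_add hlogpos _ _
  have hL2 : (Real.log x ^ A) ^ 2 = Real.log x ^ (2 * A) := by
    rw [← Real.rpow_natCast, ← Real.rpow_mul hlogpos.le]
    congr 1
    push_cast
    ring
  have hLc : 0 < Real.log x ^ (2 * c) := Real.rpow_pos_of_pos hlogpos _
  have hLA : 0 < Real.log x ^ (2 * A) := Real.rpow_pos_of_pos hlogpos _
  calc (∑ q ∈ Icc 1 Q, K ^ ω q * primeCountingAPErr x q) ^ 2
      ≤ (∑ q ∈ Icc 1 Q, c ^ ω q * primeCountingAPErr x q) * ∑ q ∈ Icc 1 Q, primeCountingAPErr x q := hCS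
    _ ≤ (4 * x * (Real.exp (2 * c * 5) * Real.log x ^ (2 * c))) * (C * (x / Real.log x ^ (2 * A + 2 * c))) :=
        mul_le_mul hB1 hB2 (Finset.sum_nonneg fun q _ => hE0 q)
          (mul_nonneg (mul_nonneg (by norm_num) hx0.le) (mul_nonneg (Real.exp_pos _).le hLc.le))
    _ = (Real.sqrt B * (x / Real.log x ^ A)) ^ 2 := by
        rw [mul_pow, Real.sq_sqrt hB0, div_pow, hL2, hL1, hB]
        field_simp

end Literature.NumberTheory.Sieve
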